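import Summits.QuantumFields.YangMills.Theorems.BalabanUVNodesPortHDecayOfRows
import Literature.MathematicalPhysics.QuantumFieldTheory.Balaban1983to89.B12ChartGaugeFlow48

/-!
# NODE-O cover ∕ ◇ LENS-1 («cauchy-analytic») g7 — `LENS-1-TransverseWard-v2.lean`: RE-GAUGE THE LEGS, NOT THE RECORD
# (the typed hinge of NODE v8: the (4.35)∕(5.10) Cauchy engine accepts ANY gauge representative of the response, so its decay rows may be
# stated on the TRANSVERSE ∕ selector-free representative instead of the tube-polluted `recordHr`)

WHY (cell record 2026-08-31).  ★★ DEF-1 g35's TUBE FINDING (`ym-nodeO-def-1/g35/DEF-1-g35-TUBE-FINDING.md`, 152c6bd9…): GIVEN HypAn the record's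
re-gauged response `recordHr = ξ·H e_l·ρ₈ + ∂χ·ρ₈` carries a NON-DECAYING pure-gauge term `∂χ` along the coordinate tube through the source (the
forward-wrapping legs of `T4RootedResidualGauge`; the (2.12)-Landau dressing only quotients block-mean-zero potentials), so the displayed decay
hypotheses Tok-182 ∕ ‴ (sup-norm decay OF `recordHr`) are FALSE-SHAPED, while the transverse part `ξ·H e_l` decays (toy (3,9): ×90 over 4 blocks).
Engine C WARD-W2G (RELAY 442): the registered graded composite kernel IS two-leg transverse (D₁⁺ = 1.269e−12, D₂⁻ = 1.574e−12).  Print: [I] (4.15)₁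
«⟨(δ²∕δB²)𝐄(1), B₁, ∂λ⟩ = 0 … for an arbitrary gauge function λ» (p. 284).  THIS FILE types the consequence for the K0ᴬ decay road: the kernel words
`Σ_X Re ∂²(𝐄_X∘χ_X)[h_X(x), h_X(y)]` do not see a pure-gauge change of either leg, hence the (R1ᴰ)-type decay row may be asked of ANY table of legs that
agrees with the honest linearisation `dι(0)` MODULO GAUGE — e.g. the selector-free [B6] (2.35) `H` ([B6] Prop. 2.5 decay: tree ✓ `B6BlockDecayHjCovV1.abs_Hj_entry_le`).

CONTENTS (generic over the `B12FormatPlus` ∕ `B12Decay510(Gauge)` names; 0 sorry; no `instance` ∕ `notation`; standard axioms):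
§0 (Literature-side, ns `…Balaban1983to89.B12ChartGaugeFlow48`; v2) the two hypothesis-form rows of [I] (4.8): `ChartGaugeFlow act coords χ gradLeg`
   (a LOCAL gauge function: one-parameter chart maps intertwined ON THE COORDINATES the piece reads) and `ChartSymm act χ n T` (a CONSTANT one: a global
   chart symmetry), + non-vacuity `chartSymm_of_chartEquivariant` ∕ `chartSymm_one`.  (Audit: Prop-valued defs belong in Literature — landing split below.)
§1 calculus kernels — `fderiv_eq_zero_of_comp_symm` ((4.14) transported along a chart symmetry), `fderiv_fderiv_apply_eq_zero_of_eventually`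
   (a first derivative vanishing along a curve through `0` ⟹ the Hessian kills the curve's velocity), `mixedDeriv_congr_of_null_legs` (leg swap by
   bilinearity + symmetry of the second derivative of an analytic function).
§2 ★ `fderiv_fderiv_flowLeg_eq_zero` — W2♭ for ONE charted piece: invariance under a one-parameter family of local chart symmetries + (4.14) at the
   origin ⟹ `D²f(0)[ζ] = 0` for the family's velocity `ζ` at the origin ([I] (4.15)₁ in coordinates, hypothesis form on the flow).
§3 ★ `kernelBound_of_gauge_transverse` ∕ `abs_twoPoint_le_of_gauge_transverse` — `B12Decay510Gauge.kernelBound_of_gauge` ∕ `abs_twoPoint_le_of_gauge`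
   with the representation row on legs `h` and the DECAY row on other legs `hT`, provided `D²𝐄_X(0)[h − hT] = 0` (the (5.10) chain per finite system).
§4 ★★ `ward2_of_gaugeInv119` — (1.19) for the pieces (`GaugeInv119`, the sixth conjunct of `FormatPlusG`) + `ChartGaugeFlow` + `Chart44D` + (1.9) +
   (4.14) ⟹ `D²(𝐄_X∘χ_X)(0)[gradLeg n p] = 0` for EVERY piece, member and gauge parameter.
§5 (record-facing, generic binder list) ★★ `sum_mixedDeriv_congr_of_gaugeLegs` — the kernel sum on legs `a, b` equals the kernel sum on legs `a′, b′`
   whenever `a − a′`, `b − b′` are pure-gauge legs: the ONE lemma by which the tree road `PortH.decay510_plimOf_of_rows` may replace its RowL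
   «`R.Gk = dι(0)`» by RowLᵀ «`dι(0) ≡ R.Gk` modulo `gradLeg`» with `R.Gk` a TRANSVERSE table.
§6 ★★★ `Road.decay510_plimOf_of_rows_transverse` — THE TREE ROAD `PortH.decay510_plimOf_of_rows` (✓ `BalabanUVNodesPortHDecayOfRows.lean`) RE-RUN WITH
   THE RESPONSE ROWS ON A TRANSVERSE TABLE: identical binder list except RowL «`R.Gk n (e μ z) = Dιₙ(0)δ_{μz}`» ↦ RowLᵀ «`Dιₙ(0)δ_{μz} − R.Gk n (e μ z)` is a
   pure-gauge leg» + ONE structural row `ChartGaugeFlow act coords χ gradLeg`; same conclusion `Decay510 (plimOf … 0 1) (16E₀C₉²e^{δ₁Mg c₁}K₀K₁) δ₁`.  So the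
   (R1ᴰ)∕(R3)∕(R4ᴰ)∕(R5) rows of `Response9D` may be displayed on the selector-free response (NODE v8 (‴ᵀ)), where they are TRUE-shaped given HypAn;
   + `chartGaugeFlow_trivial` ∕ `decay510_plimOf_of_rows_of_transverse` — the NON-VACUITY ∕ COMPATIBILITY certificate (cell rule (N)): the trivial flow
   inhabits the structural row and the transverse road SPECIALISES to the tree road (no junk inhabitant anywhere).
§7 (v2, ◆ CRIT-1 V-CRIT1-g35-v8's optional sharpening) ★★ `sum_mixedDeriv_congr_of_symmGaugeLegs` + ★★★ `Road.decay510_plimOf_of_rows_transverseSymm` —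
   RowLᵀ♯ «`Dιₙ(0)δ − T (R.Gk n (e μ z))` is a pure-gauge leg for ONE chart symmetry `T` of member `n`» (the root's constant conjugation `Ad_{h₀}` surviving
   the rooted gauge is LEGAL: (1.19) + (4.8) make `∂²(𝐄∘χ)[Ta, Tb] = ∂²(𝐄∘χ)[a, b]`); + `decay510_plimOf_of_rows_transverse_of_symm` (♯ ⟹ ᵀ with `T = 1`).
LANDING SPLIT (★★★ №518 (1), ◆ audit advisory): §0 → `Literature/MathematicalPhysics/QuantumFieldTheory/Balaban1983to89/B12ChartGaugeFlow48.lean`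
(hypothesis-form named facts with cite tags, where Prop-valued defs are not `vendored-fact`); §1–§7 → `Summits/…/Theorems/BalabanUVNodesK0AxTransverseWard.lean`
importing it (`--supports stmt-QuantumFields-27238 --as helper`); decl names unchanged.

LANDING NOTE (porter `ymgap-nodeO-port-PTB-1` g4, 2026-08-31): this is ◇ lens-1 g7's NODE v8∕v8.1 companion `nodeO-cover/LENS-1-TransverseWard-v2.lean`
(b4441b0d63812759; farm rc 0 · 0 sorry · std axioms) LANDED under the refuter's custody cut (◆ CRIT-1 g35 06:03:20Z PASS ×4, 06:07:00Z v2 PASS) and hosting word: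
§0 (the two hypothesis-form rows `ChartGaugeFlow`, `ChartSymm`) is the Literature file `…/Balaban1983to89/B12ChartGaugeFlow48.lean`; §1–§5 + §7 are THIS file; the
record-facing road §6∕§7′ is `…/Theorems/BalabanUVNodesK0AxTransverseWardRoad.lean` (400-line rule).  Decl names and statements UNCHANGED from v2; namespace
`Summit.QuantumFields.YangMills.Theorems.K0AxTransverseWard`.  `--supports stmt-QuantumFields-27238 --as helper`.  Leaf (D) of the node = this porter's
✓`rowR4D_LocUniv_sandwich` ∕ `response9D_LocUniv_of_tokens` (transverse table `recordGkLocWξ … Finset.univ`); leaves (B)(C)♯ OPEN at the record (BLOCKED-ON P0 for (C)♯).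

HONEST FRAMING.  Calculus ∕ bilinearity ∕ generic implications over DISPLAYED rows; NOTHING of Bałaban ([I] Thm 1, (1.19)–(1.22), (4.8), (4.14)–(4.15),
(4.35)–(4.37), (5.10); [15] Thm 1, Prop. 9, (190); [B6] Prop. 2.5 AT THE RECORD) is asserted, ported or discharged here; the rows of §4 are inhabited
only by the trivial flow ∕ identity (compatibility, not the NEEDED legs — that is leaf (B) at the record); typed ≠ proved; K0ᴬ `Record13SepCoPHInhabitedAx` (stmt-QuantumFields-27238) OPEN; K0⁷ 20541 ASIDE∕OPEN; NODE O 0∕1; COUNT 8∕28 ·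
K 1∕4 UNMOVED; ONE finite `𝕋⁴_{L^K}` at fixed ε — NOT continuum ∕ OS ∕ Clay; **the Yang–Mills mass gap (Clay) is NOT proved by any of this.**
[I] = [Balaban1987RG1], [15] = [Balaban1985Variational], [B6] = [Balaban1984PropagatorsII].  Author: planner seat `ymgap-nodeO-lens-1` g7 (2026-08-31).
-/

noncomputable section

open scoped BigOperators Topology
open Set Filter Metric

namespace Summit.QuantumFields.YangMills.Theorems.K0AxTransverseWard

open Literature.MathematicalPhysics.QuantumFieldTheory.Balaban1983to89.B12ChartGaugeFlow48

open Literature.MathematicalPhysics.QuantumFieldTheory.Balaban1983to89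
open Literature.MathematicalPhysics.QuantumFieldTheory.Balaban1983to89.B12Decay510 (SiteGeometry KernelBound GeomLeaf CubeSumLeaf TreeLeaf delta1 mixedDeriv
  abs_twoPoint_le_delta1)
open Literature.MathematicalPhysics.QuantumFieldTheory.Balaban1983to89.B12Decay510Gauge (kernelBound_of_gauge)
open Literature.MathematicalPhysics.QuantumFieldTheory.Balaban1983to89.Beta.RemainderLocality (mixedDeriv_eq_fderiv_fderiv)
open Literature.MathematicalPhysics.QuantumFieldTheory.Balaban1983to89.B12FormatPlus

/-! ## §1  Calculus kernels -/

section Calculus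

variable {V : Type*} [NormedAddCommGroup V] [NormedSpace ℂ V]

/-- **(4.14) transported along a chart symmetry.**  If `f ∘ φ = f` near `0`, `φ` has a surjective derivative at `0`, `f` is differentiable at `φ 0`
and `Df(0) = 0`, then `Df(φ 0) = 0` (chain rule). [cite: Balaban1987RG1, (4.14) p.284 (bookkeeping)] -/
theorem fderiv_eq_zero_of_comp_symm {f : V → ℂ} {φ : V → V} {L : V →L[ℂ] V}
    (hinv : (fun u => f (φ u)) =ᶠ[𝓝 0] f) (hφ : HasFDerivAt φ L 0) (hL : Function.Surjective L)
    (hd : DifferentiableAt ℂ f (φ 0)) (hW : fderiv ℂ f 0 = 0) : fderiv ℂ f (φ 0) = 0 := by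
  have h1 : fderiv ℂ (fun u => f (φ u)) 0 = fderiv ℂ f 0 := hinv.fderiv_eq
  have h2 : HasFDerivAt (fun u => f (φ u)) ((fderiv ℂ f (φ 0)).comp L) 0 := hd.hasFDerivAt.comp 0 hφ
  rw [h2.fderiv, hW] at h1
  ext v
  obtain ⟨u, rfl⟩ := hL v
  have := congrArg (fun T : V →L[ℂ] ℂ => T u) h1
  simpa using this

/-- **A first derivative vanishing along a curve through `0` ⟹ the Hessian kills the curve's velocity.**  If `Df(c t) = 0` for `t` near `0`, `c 0 = 0`,
`c′(0) = ζ` and `Df` is differentiable at `0`, then `D²f(0)[ζ] = 0`. [cite: Balaban1987RG1, (4.15) p.284 (bookkeeping)] -/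
theorem fderiv_fderiv_apply_eq_zero_of_eventually {f : V → ℂ} {c : ℝ → V} {ζ : V}
    (hc : HasDerivAt c ζ 0) (hc0 : c 0 = 0) (hzero : ∀ᶠ t in 𝓝 (0 : ℝ), fderiv ℂ f (c t) = 0)
    (hd : DifferentiableAt ℂ (fderiv ℂ f) 0) : fderiv ℂ (fderiv ℂ f) 0 ζ = 0 := by
  have hF : HasFDerivAt (fderiv ℂ f) ((fderiv ℂ (fderiv ℂ f) 0).restrictScalars ℝ) (c 0) := by
    rw [hc0]; exact hd.hasFDerivAt.restrictScalars ℝ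
  have hcomp : HasDerivAt (fun t => fderiv ℂ f (c t)) (((fderiv ℂ (fderiv ℂ f) 0).restrictScalars ℝ) ζ) 0 :=
    hF.comp_hasDerivAt 0 hc
  have hconst : HasDerivAt (fun t => fderiv ℂ f (c t)) 0 0 := by
    have : (fun t => fderiv ℂ f (c t)) =ᶠ[𝓝 0] fun _ => (0 : V →L[ℂ] ℂ) := hzero
    exact (hasDerivAt_const (0 : ℝ) (0 : V →L[ℂ] ℂ)).congr_of_eventuallyEq this
  have := hcomp.unique hconst
  simpa using this

/-- **Leg swap.**  For `f` analytic at `0`, the mixed derivative `∂²f[a, b]` is unchanged when each leg is moved by a NULL direction of the Hessian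
(bilinearity + symmetry of the second derivative). [cite: Balaban1987RG1, (4.15) p.284 with (4.35) p.290 (bookkeeping)] -/
theorem mixedDeriv_congr_of_null_legs {f : V → ℂ} (hf : AnalyticAt ℂ f 0) {a a' b b' : V}
    (ha : fderiv ℂ (fderiv ℂ f) 0 (a - a') = 0) (hb : fderiv ℂ (fderiv ℂ f) 0 (b - b') = 0) :
    mixedDeriv f a b = mixedDeriv f a' b' := by
  have hd : DifferentiableAt ℂ (fderiv ℂ f) 0 := hf.fderiv.differentiableAt
  have hsymm : IsSymmSndFDerivAt ℂ f 0 := (hf.contDiffAt (n := ⊤)).isSymmSndFDerivAt le_top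
  rw [mixedDeriv_eq_fderiv_fderiv hd, mixedDeriv_eq_fderiv_fderiv hd]
  set F := fderiv ℂ (fderiv ℂ f) 0 with hF
  have h1 : F b a = F b' a := by
    have : F b = F b' + F (b - b') := by rw [← map_add]; congr 1; abel
    rw [this, hb, add_zero]
  have h2 : F b' a = F b' a' := by
    rw [hsymm b' a, hsymm b' a']
    have : F a = F a' + F (a - a') := by rw [← map_add]; congr 1; abel
    rw [this, ha, add_zero]
  rw [h1, h2]

end Calculus

/-! ## §2  W2♭ for ONE charted piece: chart-symmetry flow + (4.14) ⟹ the Hessian kills the flow's velocity -/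

section Ward2

variable {V : Type*} [NormedAddCommGroup V] [NormedSpace ℂ V]

/-- ★ **W2♭ — [I] (4.15)₁ in coordinates, hypothesis form on the flow.**  `f` analytic on an open `U ∋ 0` with `Df(0) = 0` ((4.14)); a family
`φ t` of maps with `f ∘ φ t = f` near `0` for `t` near `0` (gauge invariance of the charted piece), each with a surjective derivative at `0`, whose orbit
of the origin `t ↦ φ t 0` starts at `0` with velocity `ζ` (the pure-gauge leg `−∂λ` of (4.8)) ⟹ `D²f(0)[ζ] = 0`, i.e. `⟨f⁽²⁾(0), ζ, B⟩ = 0` for all `B`.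
[cite: Balaban1987RG1, (4.8) p.283, (4.14)–(4.15) p.284] -/
theorem fderiv_fderiv_flowLeg_eq_zero {f : V → ℂ} {U : Set V} (hU : IsOpen U) (h0 : (0 : V) ∈ U) (hf : AnalyticOnNhd ℂ f U)
    (hW : fderiv ℂ f 0 = 0) {φ : ℝ → V → V} {L : ℝ → (V →L[ℂ] V)} {ζ : V}
    (hinv : ∀ᶠ t in 𝓝 (0 : ℝ), (fun u => f (φ t u)) =ᶠ[𝓝 0] f)
    (hφ : ∀ᶠ t in 𝓝 (0 : ℝ), HasFDerivAt (φ t) (L t) 0 ∧ Function.Surjective (L t))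
    (hc : HasDerivAt (fun t => φ t 0) ζ 0) (hc0 : φ 0 0 = 0) :
    fderiv ℂ (fderiv ℂ f) 0 ζ = 0 := by
  -- the orbit of the origin stays in `U` for small `t`
  have hcts : ContinuousAt (fun t => φ t 0) 0 := hc.continuousAt
  have hinU : ∀ᶠ t in 𝓝 (0 : ℝ), φ t 0 ∈ U := by
    have : U ∈ 𝓝 (φ 0 0) := by rw [hc0]; exact hU.mem_nhds h0
    exact hcts.preimage_mem_nhds this
  -- (4.14) at every point of the orbit
  have hzero : ∀ᶠ t in 𝓝 (0 : ℝ), fderiv ℂ f (φ t 0) = 0 := by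
    filter_upwards [hinv, hφ, hinU] with t ht hφt htU
    exact fderiv_eq_zero_of_comp_symm ht hφt.1 hφt.2 (hf _ htU).differentiableAt hW
  exact fderiv_fderiv_apply_eq_zero_of_eventually hc hc0 hzero (hf 0 h0).fderiv.differentiableAt

end Ward2

/-! ## §3  The (5.10) chain per finite system with the decay row on TRANSVERSE legs -/

section Kernel

variable {S₀ : LocDomainSys} {C₀ : B12.CubeCover S₀} {Λ₀ : Type*} {W : Type*} [NormedAddCommGroup W] [NormedSpace ℂ W]

/-- ★ **KERNEL BOUND, TRANSVERSE LEGS.**  As `B12Decay510Gauge.kernelBound_of_gauge`, but the representation row is on legs `h` (the honest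
linearisation) while the gauge-decay row is on legs `hT`, with `D²𝐄_X(0)[h_X(x) − hT_X(x)] = 0` (W2♭: the difference is pure gauge).
[cite: Balaban1987RG1, (4.3)–(4.5) pp.281–282, (4.15) p.284, (4.35) p.290; Balaban1985Variational, Prop. 9 p.309] -/
theorem kernelBound_of_gauge_transverse (G : SiteGeometry C₀ Λ₀) (EX : S₀.Dom → W → ℂ) (D : S₀.Dom → Set W)
    (h hT : S₀.Dom → Λ₀ → W) (E2 : S₀.Dom → Λ₀ → Λ₀ → ℝ) {E₀ Bh κ δ₀ : ℝ} (hBh : 0 ≤ Bh)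
    (hD : ∀ X, Convex ℝ (D X) ∧ Balanced ℂ (D X) ∧ IsOpen (D X) ∧ (0 : W) ∈ D X)
    (han : ∀ X, AnalyticOnNhd ℂ (EX X) (D X))
    (h118 : ∀ X, ∀ w ∈ D X, ‖EX X w‖ ≤ E₀ * Real.exp (-κ * S₀.dj X))
    (hrepr : ∀ X x y, E2 X x y = (mixedDeriv (EX X) (h X x) (h X y)).re)
    (hnull : ∀ X x, fderiv ℂ (fderiv ℂ (EX X)) 0 (h X x - hT X x) = 0)
    (hhT : ∀ X x, gauge (D X) (hT X x) ≤ Bh * Real.exp (-δ₀ * G.distD x X)) :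
    KernelBound G E2 (16 * E₀ * Bh ^ 2) κ δ₀ :=
  kernelBound_of_gauge G EX D hT E2 hBh hD han h118
    (fun X x y => by rw [hrepr, mixedDeriv_congr_of_null_legs (han X 0 (hD X).2.2.2) (hnull X x) (hnull X y)]) hhT

/-- ★ **(5.10) ON ONE FINITE SYSTEM, TRANSVERSE LEGS**: `|Σ_X E2_X(x,y)| ≤ 16E₀B_h² e^{δ₁Mc₁} K₀K₁ e^{−δ₁ρ(x,y)}` with the decay row on the transverse legs.
[cite: Balaban1987RG1, (5.10) p.293, (4.35)–(4.37) pp.290–291, (4.15) p.284] -/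
theorem abs_twoPoint_le_of_gauge_transverse (G : SiteGeometry C₀ Λ₀) {ρ : Λ₀ → Λ₀ → ℝ} (EX : S₀.Dom → W → ℂ) (D : S₀.Dom → Set W)
    (h hT : S₀.Dom → Λ₀ → W) (E2 : S₀.Dom → Λ₀ → Λ₀ → ℝ) {E₀ Bh κ δ₀ M c₁ K₀ K₁ : ℝ} (hE₀ : 0 ≤ E₀) (hBh : 0 ≤ Bh)
    (hK₀ : 0 ≤ K₀) (hδ₀ : 0 ≤ δ₀) (hκ : 0 ≤ κ) (hM : 0 < M)
    (hD : ∀ X, Convex ℝ (D X) ∧ Balanced ℂ (D X) ∧ IsOpen (D X) ∧ (0 : W) ∈ D X)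
    (han : ∀ X, AnalyticOnNhd ℂ (EX X) (D X))
    (h118 : ∀ X, ∀ w ∈ D X, ‖EX X w‖ ≤ E₀ * Real.exp (-κ * S₀.dj X))
    (hrepr : ∀ X x y, E2 X x y = (mixedDeriv (EX X) (h X x) (h X y)).re)
    (hnull : ∀ X x, fderiv ℂ (fderiv ℂ (EX X)) 0 (h X x - hT X x) = 0)
    (hhT : ∀ X x, gauge (D X) (hT X x) ≤ Bh * Real.exp (-δ₀ * G.distD x X))
    (hgeo : GeomLeaf G ρ M c₁) (hcube : CubeSumLeaf G (δ₀ / 2) K₁) (htree : TreeLeaf C₀ (κ / 2) K₀) (x y : Λ₀) :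
    |∑ X, E2 X x y| ≤ 16 * E₀ * Bh ^ 2 * Real.exp (delta1 δ₀ κ M * M * c₁) * K₀ * K₁ * Real.exp (-(delta1 δ₀ κ M) * ρ x y) :=
  abs_twoPoint_le_delta1 G (by positivity) hK₀ hδ₀ hκ hM
    (kernelBound_of_gauge_transverse G EX D h hT E2 hBh hD han h118 hrepr hnull hhT) hgeo hcube htree x y

end Kernel

/-! ## §4  Generic rows over the `B12FormatPlus` names: the chart-level gauge flow ([I] (4.8)) and W2♭ for the pieces of the (1.19)-mould -/

section Rows

variable {S : ℕ → LocDomainSys} {M m : ℕ → ℕ}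

variable {Uc : (n : ℕ) → (S n).Dom → Set (Fin (M n) → ℂ)} {χ : (n : ℕ) → (S n).Dom → (Fin (m n) → ℂ) → (Fin (M n) → ℂ)}
  {D : (n : ℕ) → (S n).Dom → Set (Fin (m n) → ℂ)}

/-- The charted piece `𝐄_X ∘ χ_X` is analytic on the (4.4)-domain `D n X` (content-free transport along `Chart44D`).
[cite: Balaban1987RG1, (1.9) p.261 with (4.4) p.281 (bookkeeping)] -/
theorem analyticOnNhd_piece_chart (hC : Chart44D S M Uc m χ D) {E : Pieces S M} (hA : Analytic19 Uc E) (n : ℕ) (X : (S n).Dom) :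
    AnalyticOnNhd ℂ (fun u => E n X (χ n X u)) (D n X) := fun w hw =>
  (hA n X (χ n X w) ((hC n X).2.2.2.2.2 hw)).comp ((hC n X).2.2.2.2.1 w hw)

/-- ★★ **W2♭ FOR THE PIECES OF THE (1.19)-MOULD**: (1.19) for the pieces under the NAMED action + the chart-level gauge flow + the chart on (4.4)-domains +
(1.7) input-locality + (1.9) + (4.14) ⟹ for EVERY member, piece and gauge parameter the Hessian of the charted piece at the origin kills the pure-gauge
leg: `D²(𝐄ₙ(X)∘χ_X)(0)[gradLeg n p] = 0` — [I] (4.15)₁ per localized piece. [cite: Balaban1987RG1, (1.7) p.261, (1.19) p.263, (4.8) p.283, (4.14)–(4.15) p.284] -/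
theorem ward2_of_gaugeInv119 {Gg P : ℕ → Type*} {act : (n : ℕ) → Gg n → (Fin (M n) → ℂ) → (Fin (M n) → ℂ)}
    {coords : (n : ℕ) → (S n).Dom → Finset (Fin (M n))} {gradLeg : (n : ℕ) → P n → (Fin (m n) → ℂ)} {E : Pieces S M}
    (hG : GaugeInv119 act Uc E) (hLoc : Local17 coords E) (hfl : ChartGaugeFlow act coords χ gradLeg) (hC : Chart44D S M Uc m χ D)
    (hA : Analytic19 Uc E) (hW : Ward414 χ E) (n : ℕ) (X : (S n).Dom) (p : P n) :
    fderiv ℂ (fderiv ℂ (fun u => E n X (χ n X u))) 0 (gradLeg n p) = 0 := by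
  obtain ⟨γ, φ, L, hint, hφ, hφ0, hvel⟩ := hfl n p
  obtain ⟨-, -, hopen, h0, -, -⟩ := hC n X
  refine fderiv_fderiv_flowLeg_eq_zero hopen h0 (analyticOnNhd_piece_chart hC hA n X) (hW n X) ?_ hφ hvel hφ0
  filter_upwards [hint] with t ht
  filter_upwards [ht X] with u hu
  show E n X (χ n X (φ t u)) = E n X (χ n X u)
  rw [hLoc n X _ _ hu, hG.2 n (γ t) X]

end Rows

/-! ## §5  The kernel sum does not see pure-gauge legs (the lemma that lets RowL «`Gk = dι`» become RowLᵀ «`dι ≡ Gk` mod gauge») -/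

section LegSwap

variable {S : ℕ → LocDomainSys} {M m : ℕ → ℕ}
  {Uc : (n : ℕ) → (S n).Dom → Set (Fin (M n) → ℂ)} {χ : (n : ℕ) → (S n).Dom → (Fin (m n) → ℂ) → (Fin (M n) → ℂ)}
  {D : (n : ℕ) → (S n).Dom → Set (Fin (m n) → ℂ)}

/-- ★★ **THE KERNEL SUM ON HONEST LEGS = THE KERNEL SUM ON TRANSVERSE LEGS.**  Under (1.19) for the pieces, the chart-level gauge flow, the chart on
(4.4)-domains, (1.9) and (4.14): if `a − a′` and `b − b′` are pure-gauge legs (`gradLeg n p`), then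
`Σ_X ∂²(𝐄ₙ(X)∘χ_X)[a, b] = Σ_X ∂²(𝐄ₙ(X)∘χ_X)[a′, b′]` — piece by piece.  (With `a, b := dιₙ(0)·B₁, dιₙ(0)·B₂` the honest responses of the record's
embedding and `a′, b′` their transverse representatives, the (4.37) sum — hence the kernel words and the β-readout — is computed on the transverse legs.)
[cite: Balaban1987RG1, (4.15) p.284, (4.35)–(4.37) pp.290–291, (1.19) p.263] -/
theorem sum_mixedDeriv_congr_of_gaugeLegs {Gg P : ℕ → Type*} {act : (n : ℕ) → Gg n → (Fin (M n) → ℂ) → (Fin (M n) → ℂ)}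
    {coords : (n : ℕ) → (S n).Dom → Finset (Fin (M n))} {gradLeg : (n : ℕ) → P n → (Fin (m n) → ℂ)} {E : Pieces S M}
    (hG : GaugeInv119 act Uc E) (hLoc : Local17 coords E) (hfl : ChartGaugeFlow act coords χ gradLeg) (hC : Chart44D S M Uc m χ D)
    (hA : Analytic19 Uc E) (hW : Ward414 χ E)
    (n : ℕ) {a a' b b' : Fin (m n) → ℂ} (ha : ∃ p : P n, a - a' = gradLeg n p) (hb : ∃ p : P n, b - b' = gradLeg n p) :
    ∑ X : (S n).Dom, mixedDeriv (fun u => E n X (χ n X u)) a b = ∑ X : (S n).Dom, mixedDeriv (fun u => E n X (χ n X u)) a' b' := by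
  refine Finset.sum_congr rfl fun X _ => ?_
  obtain ⟨pa, hpa⟩ := ha
  obtain ⟨pb, hpb⟩ := hb
  have han : AnalyticAt ℂ (fun u => E n X (χ n X u)) 0 := analyticOnNhd_piece_chart hC hA n X 0 (hC n X).2.2.2.1
  exact mixedDeriv_congr_of_null_legs han (by rw [hpa]; exact ward2_of_gaugeInv119 hG hLoc hfl hC hA hW n X pa)
    (by rw [hpb]; exact ward2_of_gaugeInv119 hG hLoc hfl hC hA hW n X pb)

/-- The same for the SIX-ROW MOULD `FormatPlusG` (one `∃` over the pieces: the identity holds for THE pieces of the mould, whichever they are, so it is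
stated on the functional's (4.6)-sum through `Repr17`): for every member `n`, near `B = 0` … — bookkeeping form: for any pieces `E` extracted from the
mould the leg swap holds. [cite: Balaban1987RG1, (1.6)–(1.9) p.261, (1.19) p.263, (4.15) p.284 (bookkeeping)] -/
theorem FormatPlusG.legSwap {Gg P Hg : ℕ → Type*} {act : (n : ℕ) → Gg n → (Fin (M n) → ℂ) → (Fin (M n) → ℂ)}
    {toG : (n : ℕ) → Hg n → Gg n} {A : (n : ℕ) → Hg n → ((Fin (m n) → ℂ) →L[ℂ] (Fin (m n) → ℂ))}
    {coords : (n : ℕ) → (S n).Dom → Finset (Fin (M n))} {W : ℕ → Type*} [∀ n, TopologicalSpace (W n)] [∀ n, Zero (W n)]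
    {Φf : (n : ℕ) → W n → ℂ} {ι : (n : ℕ) → W n → (Fin (m n) → ℂ)} {wrap : (n : ℕ) → Finset (S n).Dom}
    {emb : (n : ℕ) → (S n).Dom → (S (n + 1)).Dom} {πc : (n : ℕ) → (S n).Dom → (Fin (M (n + 1)) → ℂ) → (Fin (M n) → ℂ)} {E₀ κ α₂ : ℝ}
    {gradLeg : (n : ℕ) → P n → (Fin (m n) → ℂ)}
    (h : FormatPlusG S M act Uc coords m χ Φf ι wrap emb πc E₀ κ) (hfl : ChartGaugeFlow act coords χ gradLeg) (hC : Chart44D S M Uc m χ D)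
    (hEq : ChartEquivariant toG act χ A) (hC44 : Chart44 S M Uc m χ α₂) (hα : 0 < α₂) (hN : ∀ n, NoInvariantCovector (A n)) :
    ∃ E : Pieces S M, Analytic19 Uc E ∧ Bound118 S Uc E E₀ κ ∧ Local17 coords E ∧ Repr17 S E χ Φf ι ∧ PieceVolIndep S M wrap emb πc E ∧
      GaugeInv119 act Uc E ∧ Ward414 χ E ∧
      ∀ n (a a' b b' : Fin (m n) → ℂ), (∃ p : P n, a - a' = gradLeg n p) → (∃ p : P n, b - b' = gradLeg n p) →
        ∑ X : (S n).Dom, mixedDeriv (fun u => E n X (χ n X u)) a b = ∑ X : (S n).Dom, mixedDeriv (fun u => E n X (χ n X u)) a' b' := by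
  obtain ⟨E, hA, hB, hL, hR, hV, hG⟩ := h
  have hW : Ward414 χ E := ward414_of_gaugeInv119 hG hEq hC44 hα hA hN
  exact ⟨E, hA, hB, hL, hR, hV, hG, hW, fun n a a' b b' ha hb => sum_mixedDeriv_congr_of_gaugeLegs hG hL hfl hC hA hW n ha hb⟩

end LegSwap

/-! ## §7  THE `Ad`-SHARPENED SWAP (◆ CRIT-1 V-CRIT1-g35-v8, optional sharpening): legs congruent modulo pure-gauge legs AND one global chart symmetry per member -/

section SymmSwap

variable {S : ℕ → LocDomainSys} {M m : ℕ → ℕ}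
  {Uc : (n : ℕ) → (S n).Dom → Set (Fin (M n) → ℂ)} {χ : (n : ℕ) → (S n).Dom → (Fin (m n) → ℂ) → (Fin (M n) → ℂ)}
  {D : (n : ℕ) → (S n).Dom → Set (Fin (m n) → ℂ)}

/-- **A chart symmetry does not change the kernel of a gauge-invariant piece**: `∂²(𝐄ₙ(X)∘χ_X)[Ta, Tb] = ∂²(𝐄ₙ(X)∘χ_X)[a, b]` — by (1.19) for the NAMED
action (global in the configuration) and the intertwining, `(𝐄ₙ(X)∘χ_X)∘T = 𝐄ₙ(X)∘χ_X` as functions; then the chain rule through the CLM `T`.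
[cite: Balaban1987RG1, (1.19) p.263, (4.8) p.283, (4.35) p.290 (bookkeeping)] -/
theorem mixedDeriv_congr_chartSymm {Gg : ℕ → Type*} {act : (n : ℕ) → Gg n → (Fin (M n) → ℂ) → (Fin (M n) → ℂ)} {E : Pieces S M}
    (hG : GaugeInv119 act Uc E) (hC : Chart44D S M Uc m χ D) (hA : Analytic19 Uc E) {n : ℕ} {T : (Fin (m n) → ℂ) →L[ℂ] (Fin (m n) → ℂ)}
    (hT : ChartSymm act χ n T) (X : (S n).Dom) (a b : Fin (m n) → ℂ) :
    mixedDeriv (fun u => E n X (χ n X u)) (T a) (T b) = mixedDeriv (fun u => E n X (χ n X u)) a b := by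
  obtain ⟨g, hg⟩ := hT
  have hF : AnalyticAt ℂ (fun u => E n X (χ n X u)) 0 := analyticOnNhd_piece_chart hC hA n X 0 (hC n X).2.2.2.1
  obtain ⟨r, hr, hball⟩ : ∃ r > 0, ∀ y ∈ Metric.ball (0 : Fin (m n) → ℂ) r, DifferentiableAt ℂ (fun u => E n X (χ n X u)) y := by
    obtain ⟨s, hs, hsub⟩ := Metric.mem_nhds_iff.1 hF.eventually_analyticAt
    exact ⟨s, hs, fun y hy => (hsub hy).differentiableAt⟩
  have hfun : (fun u => (fun u => E n X (χ n X u)) (T u)) = fun u => E n X (χ n X u) := by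
    funext u; show E n X (χ n X (T u)) = E n X (χ n X u); rw [hg X u, hG.2 n g X]
  rw [← Beta.RemainderLocality.mixedDeriv_comp_clm hr hball T a b, hfun]

/-- ★★ **THE `Ad`-SHARPENED LEG SWAP FOR THE (4.37) SUM**: if `a − T a′` and `b − T b′` are pure-gauge legs for ONE chart symmetry `T` of member `n`, then
`Σ_X ∂²(𝐄ₙ(X)∘χ_X)[a, b] = Σ_X ∂²(𝐄ₙ(X)∘χ_X)[a′, b′]` ((4.15)₁ per piece for the gradients, (1.19)+(4.8) for the global rotation).  The legal form of
RowLᵀ♯ «honest legs ≡ tabulated legs modulo gradients and one global `Ad_{h₀}` per member» (◆'s P0-lighter reading of leaf (C)).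
[cite: Balaban1987RG1, (4.15) p.284, (4.8) p.283, (1.19) p.263, (4.35)–(4.37) pp.290–291] -/
theorem sum_mixedDeriv_congr_of_symmGaugeLegs {Gg P : ℕ → Type*} {act : (n : ℕ) → Gg n → (Fin (M n) → ℂ) → (Fin (M n) → ℂ)}
    {coords : (n : ℕ) → (S n).Dom → Finset (Fin (M n))} {gradLeg : (n : ℕ) → P n → (Fin (m n) → ℂ)} {E : Pieces S M}
    (hG : GaugeInv119 act Uc E) (hLoc : Local17 coords E) (hfl : ChartGaugeFlow act coords χ gradLeg) (hC : Chart44D S M Uc m χ D)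
    (hA : Analytic19 Uc E) (hW : Ward414 χ E) (n : ℕ) {T : (Fin (m n) → ℂ) →L[ℂ] (Fin (m n) → ℂ)} (hT : ChartSymm act χ n T)
    {a a' b b' : Fin (m n) → ℂ} (ha : ∃ p : P n, a - T a' = gradLeg n p) (hb : ∃ p : P n, b - T b' = gradLeg n p) :
    ∑ X : (S n).Dom, mixedDeriv (fun u => E n X (χ n X u)) a b = ∑ X : (S n).Dom, mixedDeriv (fun u => E n X (χ n X u)) a' b' := by
  rw [sum_mixedDeriv_congr_of_gaugeLegs hG hLoc hfl hC hA hW n ha hb]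
  exact Finset.sum_congr rfl fun X _ => mixedDeriv_congr_chartSymm hG hC hA hT X a' b'

end SymmSwap

end Summit.QuantumFields.YangMills.Theorems.K0AxTransverseWard

end
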